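import Summits.HodgeConjecture.HodgeConjecture.Theorems.F0P3cStCharTSUpTrTubeSocketAnyCartan   -- ★ (N4-A) `tubeJacobianSocket_cartan` (this seat): the socket at ANY Cartan; brings `sqrt_dgRadicand_conj`
import Summits.HodgeConjecture.HodgeConjecture.Theorems.F0P3cStCharTSWeylCartanJacobian          -- ★ (E1b) `lintegral∕integral_cartanSet_eq_of_tubeJacobian_local` (F0P3a-p05)
import Summits.HodgeConjecture.HodgeConjecture.Theorems.F0P3cStCharTSWeylCartanOrbInt            -- ★ (E3) `classOrbitalIntegral_mk_eq_integral_conjFamily_cartan` (F0P3a-p05)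
import HarnessLib

/-!
# F0 · P3c · ROAD «UP-TR» brick (N4-B): THE TUBE (WEYL) FORMULA AT **ANY** CARTAN SUBGROUP `T = Z(γ₀)` OF `U(Φ₃)(L⁺_v)`, SOCKET DISCHARGED — `∫⁻` form, Bochner form and
# the class-function form with canonical orbital integrals (Rogawski 1990 §12.5 p. 182; Harish-Chandra 1970 Lemma 42)

Cell `pub/hodgecm-mathlib`, crux H413 = `stmt-HodgeConjecture-24833` (lane `--supports … --as helper`); seat LH10-p01 (g8); ROAD «UP-TR» v2 (holder F0P3-p02 (g23)) §B brick
(N4) «TUBE-ANY-CARTAN-G», FILE B of 3 (FILE A = ★ `…UpTrTubeSocketAnyCartan`; FILE C = `…UpTrTubeOrbitSum`, the «W-unfolded» form).  THEOREMS ONLY; sorry-free; no definition ∕ instance ∕ notation ∕ named fact; ★-only imports; axioms TRIO.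

WHAT (all at ANY Cartan `T = Z(γ₀)`, `γ₀` regular, `v` non-split; `tT` THE Haar measure of `T` with inversion symmetry and `tT (compactCore T) = 1`; `ν` Haar; weight letter
`D(t) = √(∏_w |disc χ_t|_w · (∏_w |det t|_w)⁻²)` (= `D_G(t)²` under the datum's `eDG`, ★ `DG_sq_eq_sqrt`); `G_T = ⋃ₓ x T^{reg} x⁻¹`; `[N:T] = (T.subgroupOf N_G(T)).index`):
* (a) **`lintegral_cartanSet_eq`** `[N:T] · ∫⁻_{G_T} F dν = ∫⁻_{T^{reg}} D(t) · ∫⁻_{G⧸T} F(Φ(q,t)) d(ν∕tT) dtT` and (a′) **`integral_cartanSet_eq`** (Bochner) — ★ (E1b) with its socket `hJacLoc`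
  PAID by ★ (N4-A) `tubeJacobianSocket_cartan`;
* (b) **`setIntegral_mul_classFun_cartanSet_eq`** `∫_{G_T} f κ dν = [N:T]⁻¹ • ∫_{T^{reg}} D(t) • (κ(t) · classOrbitalIntegral mQv f ⟦t⟧) dtT` for a class function `κ` and `mQv` CANONICAL (★ (E3)) —
  the `T`-summand of ★ (E2b) `integral_mul_classFun_eq_sum_classOrbitalIntegral_of_tubeJacobians`, now unconditional and for every Cartan (not only a representative);
* (c) the «W-UNFOLDED» form for a NON-invariant torus weight `K` (orbit sum `Σ_{t ∈ T, t ∼ y} K t`) is FILE C ★-to-be `…UpTrTubeOrbitSum.setIntegral_mul_orbitSum_cartanSet_eq`.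
HONEST LABEL: count-neutral; UP-TR block consequents move only at the rider editions; organs 2 = 2; h413 registry untouched; HC_CM is proved only modulo the printed citations
until rung 0 closes.

## References
* [Rogawski1990] J. D. Rogawski, *Automorphic Representations of Unitary Groups in Three Variables*, Ann. of Math. Stud. 123 (1990), §12.5 p. 182 (Weyl integration formula; «the map
  `(g, γ) ↦ g γ g⁻¹` is `|Ω(T,G)|`-to-one»), §4.3 (4.3.1) p. 43, §1.7 p. 6.
* [HarishChandra1970] Harish-Chandra (notes by G. van Dijk), *Harmonic analysis on reductive p-adic groups*, LNM 162 (1970), Part V §4 Lemma 22, Lemma 42.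
-/

set_option autoImplicit false
-- the mandated namespace has the single-problem summit's repeated segment (`HodgeConjecture.HodgeConjecture`)
set_option linter.dupNamespace false

noncomputable section

open MeasureTheory Measure Set Filter Topology Function NumberField IsDedekindDomain Matrix
open Literature.MeasureTheory.Group
open Literature.NumberTheory.Automorphic Literature.NumberTheory.Automorphic.UnitaryGroup Literature.NumberTheory.Rogawski1990
open Literature.NumberTheory.GaloisRepresentations
open Summit.HodgeConjecture.HodgeConjecture.Cruxes.H413
open Summit.HodgeConjecture.HodgeConjecture.Cruxes.H413.F0P3cStCharTSWeylHypMeasure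
open Summit.HodgeConjecture.HodgeConjecture.Cruxes.H413.F0P3cStCharTSWeylCartanRadial
open scoped ENNReal NNReal MatrixGroups Pointwise

namespace Summit.HodgeConjecture.HodgeConjecture.Cruxes.H413.F0P3cStCharTSUpTrTubeAnyCartan

open Summit.HodgeConjecture.HodgeConjecture.Cruxes.H413.F0P3cStCharTSUpTrTubeSocketAnyCartan
open Summit.HodgeConjecture.HodgeConjecture.Cruxes.H413.F0P3cStCharTSWeylCartanJacobian
open Summit.HodgeConjecture.HodgeConjecture.Cruxes.H413.F0P3cStCharTSWeylCartanOrbInt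

section CM

variable (L : Type) [Field L] [NumberField L] [IsCMField L] (v : HeightOneSpectrum (𝓞 ↥(maximalRealSubfield L)))

/-! ## §1 The weight letter on a subgroup is measurable -/

/-- The weight letter `t ↦ √(∏_w |disc χ_t|_w · (∏_w |det t|_w)⁻²)` is measurable on every subgroup `T ≤ U(Φ₃)(L⁺_v)` (it is the square of ★ DG-FIELD's continuous closed form
`√√(·)`). [cite: Rogawski1990, §4.9 p. 54; §12.5 p. 182] -/
theorem measurable_sqrt_dgRadicand_subtype [MeasurableSpace (Gqs L v)] [BorelSpace (Gqs L v)] (T : Subgroup (Gqs L v)) :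
    Measurable fun t : ↥T => NNReal.sqrt
      ((∏ w : PlacesOver L v, IsNonarchimedeanLocalField.normAbs (w.1.adicCompletion L)
          ((((t : Gqs L v).val : GL (Fin 3) (UnitaryGroup.LocalRing L v)).val.charpoly.discr) w)) *
        ((∏ w : PlacesOver L v, IsNonarchimedeanLocalField.normAbs (w.1.adicCompletion L)
          ((((t : Gqs L v).val : GL (Fin 3) (UnitaryGroup.LocalRing L v)).val.det) w)) ^ 2)⁻¹) := by
  have h2 := (continuous_real_toNNReal.comp (F0P3cStCharTSDGField.continuous_dgFormula L v)).pow 2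
  have hG : Continuous fun g : Gqs L v => NNReal.sqrt
      ((∏ w : PlacesOver L v, IsNonarchimedeanLocalField.normAbs (w.1.adicCompletion L)
          (((g.val : GL (Fin 3) (UnitaryGroup.LocalRing L v)).val.charpoly.discr) w)) *
        ((∏ w : PlacesOver L v, IsNonarchimedeanLocalField.normAbs (w.1.adicCompletion L)
          (((g.val : GL (Fin 3) (UnitaryGroup.LocalRing L v)).val.det) w)) ^ 2)⁻¹) := by
    convert h2 using 1
    funext g
    simp only [Pi.pow_apply, Function.comp_apply, Real.toNNReal_coe, NNReal.sq_sqrt]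
  exact hG.measurable.comp measurable_subtype_coe

/-! ## §2 (a) The `∫⁻` and Bochner tube formulas at ANY Cartan, socket discharged -/

set_option maxHeartbeats 1600000 in
set_option synthInstance.maxHeartbeats 400000 in
-- instance-term unification on the CM local carrier (as ★ (E1b))
/-- **(N4-a) THE `∫⁻` TUBE FORMULA AT ANY CARTAN `T = Z(γ₀)`** of `U(Φ₃)(L⁺_v)` (`γ₀` regular, `v` non-split; `T` compact or a conjugate of `M`), for THE Haar measure `tT` of `T`
with inversion symmetry and mass one on `compactCore T`, and every Borel `F ≥ 0`:
**`[N(T):T] · ∫⁻_{G_T} F dν = ∫⁻_{t ∈ T^{reg}} √(∏_w |disc χ_t|_w (∏_w |det t|_w)⁻²) · ∫⁻_{G⧸T} F(Φ(q,t)) d(ν∕tT) dtT`** — ★ (E1b) `lintegral_cartanSet_eq_of_tubeJacobian_local` with its socket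
PAID by ★ (N4-A) `tubeJacobianSocket_cartan`. [cite: Rogawski1990, §12.5 p. 182] [cite: HarishChandra1970, Lemma 22; Lemma 42] -/
theorem lintegral_cartanSet_eq
    (hns : ∀ w : PlacesOver L v, IsCMField.complexConj L • w.1 = w.1)
    [MeasurableSpace (Gqs L v)] [BorelSpace (Gqs L v)] [LocallyCompactSpace (Gqs L v)] [SecondCountableTopology (Gqs L v)] [T2Space (Gqs L v)]
    (ν : Measure (Gqs L v)) [ν.IsHaarMeasure] [ν.IsMulRightInvariant]
    {T : Subgroup (Gqs L v)} {γ₀ : Gqs L v} (hγ₀ : IsRegularElt (γ₀.val : GL (Fin 3) (UnitaryGroup.LocalRing L v)))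
    (hT : T = Subgroup.centralizer ({γ₀} : Set (Gqs L v)))
    [MeasurableSpace (Gqs L v ⧸ T)] [BorelSpace (Gqs L v ⧸ T)]
    (tT : Measure ↥T) [tT.IsHaarMeasure] [tT.IsInvInvariant] (htT : tT (compactCore ↥T) = 1)
    (Φ : (Gqs L v ⧸ T) × ↥T → Gqs L v) (hΦ : ∀ (x : Gqs L v) (t : ↥T), Φ (QuotientGroup.mk x, t) = x * t * x⁻¹) :
    ∀ F : Gqs L v → ℝ≥0∞, Measurable F →
      ((T.subgroupOf (Subgroup.normalizer (T : Set (Gqs L v)))).index : ℝ≥0∞) *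
          ∫⁻ y in {x | ∃ g t : Gqs L v, t ∈ T ∧ IsRegularElt (t.val : GL (Fin 3) (UnitaryGroup.LocalRing L v)) ∧ g * t * g⁻¹ = x}, F y ∂ν =
        ∫⁻ t in {t : ↥T | IsRegularElt (((t : Gqs L v)).val : GL (Fin 3) (UnitaryGroup.LocalRing L v))},
          ((NNReal.sqrt
              ((∏ w : PlacesOver L v, IsNonarchimedeanLocalField.normAbs (w.1.adicCompletion L)
                  ((((t : Gqs L v).val : GL (Fin 3) (UnitaryGroup.LocalRing L v)).val.charpoly.discr) w)) *
                ((∏ w : PlacesOver L v, IsNonarchimedeanLocalField.normAbs (w.1.adicCompletion L)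
                  ((((t : Gqs L v).val : GL (Fin 3) (UnitaryGroup.LocalRing L v)).val.det) w)) ^ 2)⁻¹) : ℝ≥0) : ℝ≥0∞) *
            ∫⁻ q, F (Φ (q, t)) ∂(quotientMeasure T tT (isClosed_cartan hT) ν) ∂tT :=
  lintegral_cartanSet_eq_of_tubeJacobian_local hγ₀ hT Φ hΦ hns ν tT _ (measurable_sqrt_dgRadicand_subtype L v T)
    (tubeJacobianSocket_cartan L v hns ν hγ₀ hT tT htT Φ hΦ)

set_option maxHeartbeats 1600000 in
set_option synthInstance.maxHeartbeats 400000 in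
-- instance-term unification on the CM local carrier (as ★ (E1b))
/-- **(N4-a′) THE BOCHNER TUBE FORMULA AT ANY CARTAN**: for `g : G → ℂ` `ν`-integrable on `G_T`, `(t, q) ↦ g(Φ(q,t))` is integrable for `(D · tT|_{T^{reg}}) ⊗ (ν∕tT)` and
**`∫_{t ∈ T^{reg}} √(∏_w |disc χ_t|_w (∏_w |det t|_w)⁻²) • (∫_{G⧸T} g(Φ(q,t)) d(ν∕tT)) dtT = [N(T):T] • ∫_{G_T} g dν`** — ★ (E1b) `integral_cartanSet_eq_of_tubeJacobian_local`, socket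
PAID by ★ (N4-A). [cite: Rogawski1990, §12.5 p. 182] [cite: HarishChandra1970, Lemma 42] -/
theorem integral_cartanSet_eq
    (hns : ∀ w : PlacesOver L v, IsCMField.complexConj L • w.1 = w.1)
    [MeasurableSpace (Gqs L v)] [BorelSpace (Gqs L v)] [LocallyCompactSpace (Gqs L v)] [SecondCountableTopology (Gqs L v)] [T2Space (Gqs L v)]
    (ν : Measure (Gqs L v)) [ν.IsHaarMeasure] [ν.IsMulRightInvariant]
    {T : Subgroup (Gqs L v)} {γ₀ : Gqs L v} (hγ₀ : IsRegularElt (γ₀.val : GL (Fin 3) (UnitaryGroup.LocalRing L v)))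
    (hT : T = Subgroup.centralizer ({γ₀} : Set (Gqs L v)))
    [MeasurableSpace (Gqs L v ⧸ T)] [BorelSpace (Gqs L v ⧸ T)]
    (tT : Measure ↥T) [tT.IsHaarMeasure] [tT.IsInvInvariant] (htT : tT (compactCore ↥T) = 1)
    (Φ : (Gqs L v ⧸ T) × ↥T → Gqs L v) (hΦ : ∀ (x : Gqs L v) (t : ↥T), Φ (QuotientGroup.mk x, t) = x * t * x⁻¹)
    (g : Gqs L v → ℂ) (hg : IntegrableOn g {x | ∃ g t : Gqs L v, t ∈ T ∧ IsRegularElt (t.val : GL (Fin 3) (UnitaryGroup.LocalRing L v)) ∧ g * t * g⁻¹ = x} ν) :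
    Integrable (fun p : ↥T × (Gqs L v ⧸ T) => g (Φ (p.2, p.1)))
        (((tT.restrict {t : ↥T | IsRegularElt (((t : Gqs L v)).val : GL (Fin 3) (UnitaryGroup.LocalRing L v))}).withDensity fun t =>
            ((NNReal.sqrt
              ((∏ w : PlacesOver L v, IsNonarchimedeanLocalField.normAbs (w.1.adicCompletion L)
                  ((((t : Gqs L v).val : GL (Fin 3) (UnitaryGroup.LocalRing L v)).val.charpoly.discr) w)) *
                ((∏ w : PlacesOver L v, IsNonarchimedeanLocalField.normAbs (w.1.adicCompletion L)
                  ((((t : Gqs L v).val : GL (Fin 3) (UnitaryGroup.LocalRing L v)).val.det) w)) ^ 2)⁻¹) : ℝ≥0) : ℝ≥0∞)).prod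
          (quotientMeasure T tT (isClosed_cartan hT) ν)) ∧
      ∫ t in {t : ↥T | IsRegularElt (((t : Gqs L v)).val : GL (Fin 3) (UnitaryGroup.LocalRing L v))},
          ((NNReal.sqrt
              ((∏ w : PlacesOver L v, IsNonarchimedeanLocalField.normAbs (w.1.adicCompletion L)
                  ((((t : Gqs L v).val : GL (Fin 3) (UnitaryGroup.LocalRing L v)).val.charpoly.discr) w)) *
                ((∏ w : PlacesOver L v, IsNonarchimedeanLocalField.normAbs (w.1.adicCompletion L)
                  ((((t : Gqs L v).val : GL (Fin 3) (UnitaryGroup.LocalRing L v)).val.det) w)) ^ 2)⁻¹) : ℝ≥0) : ℝ) •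
            ∫ q, g (Φ (q, t)) ∂(quotientMeasure T tT (isClosed_cartan hT) ν) ∂tT =
        ((T.subgroupOf (Subgroup.normalizer (T : Set (Gqs L v)))).index : ℝ) •
          ∫ y in {x | ∃ g t : Gqs L v, t ∈ T ∧ IsRegularElt (t.val : GL (Fin 3) (UnitaryGroup.LocalRing L v)) ∧ g * t * g⁻¹ = x}, g y ∂ν :=
  integral_cartanSet_eq_of_tubeJacobian_local hγ₀ hT Φ hΦ hns ν tT _ (measurable_sqrt_dgRadicand_subtype L v T)
    (tubeJacobianSocket_cartan L v hns ν hγ₀ hT tT htT Φ hΦ) g hg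

/-! ## §3 (b) The class-function form with canonical orbital integrals -/

set_option maxHeartbeats 1600000 in
set_option synthInstance.maxHeartbeats 400000 in
-- instance-term unification on the CM local carrier (as ★ (E2b))
/-- **(N4-b) CLASS-FUNCTION FORM AT ANY CARTAN** (the `T`-summand of ★ (E2b) `integral_mul_classFun_eq_sum_classOrbitalIntegral_of_tubeJacobians`, socket PAID): for `mQv` CANONICAL for
the regular classes (`hcanQ`), `f` measurable, `κ` a class function on the regular set and `f · κ` `ν`-integrable on `G_T`,
**`∫_{G_T} f κ dν = [N(T):T]⁻¹ • ∫_{t ∈ T^{reg}} √(∏_w |disc χ_t|_w (∏_w |det t|_w)⁻²) • (κ(t) · classOrbitalIntegral mQv f ⟦t⟧) dtT`** («`|Ω(T,G)|⁻¹ ∫_T D_G(γ)² Φ(γ, f) κ(γ) dγ`»).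
[cite: Rogawski1990, §12.5 p. 182; §4.3 (4.3.1) p. 43] [cite: HarishChandra1970, Lemma 42] -/
theorem setIntegral_mul_classFun_cartanSet_eq
    (hns : ∀ w : PlacesOver L v, IsCMField.complexConj L • w.1 = w.1)
    [MeasurableSpace (Gqs L v)] [BorelSpace (Gqs L v)] [LocallyCompactSpace (Gqs L v)] [SecondCountableTopology (Gqs L v)] [T2Space (Gqs L v)]
    [∀ γ' : Gqs L v, MeasurableSpace (Gqs L v ⧸ Subgroup.centralizer ({γ'} : Set (Gqs L v)))]
    [∀ γ' : Gqs L v, BorelSpace (Gqs L v ⧸ Subgroup.centralizer ({γ'} : Set (Gqs L v)))]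
    (ν : Measure (Gqs L v)) [ν.IsHaarMeasure] [ν.IsMulRightInvariant]
    {mQv : OrbitalMeasureFamily (Gqs L v)} (hcanQ : mQv.IsCanonical (fun γ' => IsRegularElt (γ'.val : GL (Fin 3) (UnitaryGroup.LocalRing L v))) ν)
    {T : Subgroup (Gqs L v)} {γ₀ : Gqs L v} (hγ₀ : IsRegularElt (γ₀.val : GL (Fin 3) (UnitaryGroup.LocalRing L v)))
    (hT : T = Subgroup.centralizer ({γ₀} : Set (Gqs L v)))
    [MeasurableSpace (Gqs L v ⧸ T)] [BorelSpace (Gqs L v ⧸ T)]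
    (tT : Measure ↥T) [tT.IsHaarMeasure] [tT.IsInvInvariant] (htT : tT (compactCore ↥T) = 1)
    (f κ : Gqs L v → ℂ) (hf : Measurable f)
    (hκ : ∀ x t : Gqs L v, IsRegularElt (t.val : GL (Fin 3) (UnitaryGroup.LocalRing L v)) → κ (x * t * x⁻¹) = κ t)
    (hfκ : IntegrableOn (fun y => f y * κ y) {x | ∃ g t : Gqs L v, t ∈ T ∧ IsRegularElt (t.val : GL (Fin 3) (UnitaryGroup.LocalRing L v)) ∧ g * t * g⁻¹ = x} ν) :
    ∫ y in {x | ∃ g t : Gqs L v, t ∈ T ∧ IsRegularElt (t.val : GL (Fin 3) (UnitaryGroup.LocalRing L v)) ∧ g * t * g⁻¹ = x}, f y * κ y ∂ν =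
      (((T.subgroupOf (Subgroup.normalizer (T : Set (Gqs L v)))).index : ℝ))⁻¹ •
        ∫ t in {t : ↥T | IsRegularElt (((t : Gqs L v)).val : GL (Fin 3) (UnitaryGroup.LocalRing L v))},
          ((NNReal.sqrt
              ((∏ w : PlacesOver L v, IsNonarchimedeanLocalField.normAbs (w.1.adicCompletion L)
                  ((((t : Gqs L v).val : GL (Fin 3) (UnitaryGroup.LocalRing L v)).val.charpoly.discr) w)) *
                ((∏ w : PlacesOver L v, IsNonarchimedeanLocalField.normAbs (w.1.adicCompletion L)
                  ((((t : Gqs L v).val : GL (Fin 3) (UnitaryGroup.LocalRing L v)).val.det) w)) ^ 2)⁻¹) : ℝ≥0) : ℝ) •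
            (κ (t : Gqs L v) * classOrbitalIntegral mQv f (ConjClasses.mk (t : Gqs L v))) ∂tT := by
  have hidx : (((T.subgroupOf (Subgroup.normalizer (T : Set (Gqs L v)))).index : ℝ)) ≠ 0 :=
    Nat.cast_ne_zero.2 (index_cartan_subgroupOf_normalizer_ne_zero hγ₀ hT hns)
  -- a conjugation family of the abelian `T = Z(γ₀)` (★ `exists_conjFamily`)
  obtain ⟨Φ, hΦ⟩ := exists_conjFamily T (mul_comm_cartan hγ₀ hT)
  obtain ⟨-, heq⟩ := integral_cartanSet_eq L v hns ν hγ₀ hT tT htT Φ hΦ (fun y => f y * κ y) hfκ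
  rw [eq_inv_smul_iff₀ hidx, ← heq]
  refine setIntegral_congr_fun ?_ fun t ht => ?_
  · obtain ⟨w⟩ := (inferInstance : Nonempty (PlacesOver L v))
    exact ((isOpen_setOf_isRegularElt_cmDatum_local (L := L) (H := qsForm L) (v := v) w (hns w)).preimage continuous_subtype_val).measurableSet
  · congr 1
    -- the fibre integral of `f · κ` at a regular `t` is `κ(t) · Φ_G([t], f)`: `κ(Φ(q, t)) = κ(t)` for every `q`, then ★ (E3)
    have hpt : ∀ q : Gqs L v ⧸ T, f (Φ (q, t)) * κ (Φ (q, t)) = f (Φ (q, t)) * κ (t : Gqs L v) := by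
      intro q
      induction q using QuotientGroup.induction_on with
      | H x => rw [hΦ x t, hκ x (t : Gqs L v) ht]
    simp_rw [hpt]
    rw [integral_mul_const, mul_comm, classOrbitalIntegral_mk_eq_integral_conjFamily_cartan hγ₀ hT ν hcanQ tT htT Φ hΦ t ht f hf]

end CM

end Summit.HodgeConjecture.HodgeConjecture.Cruxes.H413.F0P3cStCharTSUpTrTubeAnyCartan

end
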